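import Summits.BirchSwinnertonDyer.Rank1Residual.X12.CMRamifiedRecordSchemaF
import Summits.BirchSwinnertonDyer.BirchSwinnertonDyer.Theorems.PrintCFramTCubeSum
import HarnessLib

/-!
# Leaf `CornerF ∧ CMRamified`, slice `p = 3`: PART F addendum — a consistent `PopRow`'s T sub-letter
# IS «a rational point of order `3` on `E_k` or on `E_{−27k}`» (p4 `PrintCFram.exists_rational_three_torsion_pair_iff` by name)

HONEST FRAMING (cell `bsd-print-cfram`, run/shared/lean/pub/bsd-print-cfram/, verbatim in every file
of the cell): PARTITION currency only — the leaf counts when its class theorem is in the kernel BY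
NAME, flag-free; Literature named facts are statement-only with cite tags, never sorried theorems;
every imported theorem carries its printed hypotheses verbatim; numbers, not adjectives. THIS FILE IS
STRUCTURE: theorems only, no definition, no named fact, nothing about any particular curve; no mark
moves (the leaf K12r, its `p = 3` slice and the regime children N / T / V of route `PrintCFram` stay OPEN).

WHAT IS HERE. The schema `X12/CMRamifiedRecordSchemaF.lean` proves from the certificates that on a
consistent `PopRow` `tSub = 1 → k ∈ ℚ² ∨ −3k ∈ ℚ²` and `tSub = 2 → k ∉ ℚ² ∧ −3k ∉ ℚ²`, and from the
PART F §1 bridge that `regime ≠ 1 ⟺` no `ℚ₃`-point of order `3` on `W`, `W^{(−3)}`. p4's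
`Theorems/PrintCFramTCubeSum.lean` (p548859) proves `exists_rational_three_torsion_pair_iff`:
`E_k(ℚ)` or `E_{−27k}(ℚ)` has a point of order `3` iff `k ∈ ℚ² ∨ −3k ∈ ℚ²` (the cube-sum classes).
Combining: **on a consistent record, `tSub = 1 ⟺ E_k` or `E_{−27k}` has a RATIONAL point of order `3`**
(`tSub = 0`: no `ℚ₃`-point of order `3`, a fortiori no rational one — `isSqQ3_iff_isSquare_padic`;
`tSub = 2`: the non-residue certificate). So the displays' T_cube / T_split split (178 / 296 classes of
conductor `< 5·10⁵`) is p4's «T = T_cube ⊔ T_split, decidable by name», record by record.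
beyond-print: NO.
-/

set_option autoImplicit false

namespace Summit.BirchSwinnertonDyer.Rank1Residual.X12.CMRamifiedRecords

open Literature.NumberTheory.EllipticCurves

namespace PopRow

/-- **On a consistent record, cube type ⟺ a RATIONAL point of order `3` on `E_k` or on `E_{−27k}`**
(p4 `PrintCFram.exists_rational_three_torsion_pair_iff`, p548859, by name). [cite: SilvermanAEC2009, Exercise 3.7] -/
theorem tSub_eq_one_iff_exists_rational_threeTorsion {r : PopRow} (h : r.consistent = true) :
    r.tSub = 1 ↔
      ((∃ P : (mordellCurve ((r.k : ℤ) : ℚ)).toAffine.Point, P ≠ 0 ∧ (3 : ℕ) • P = 0) ∨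
        (∃ P : (mordellCurve (-27 * ((r.k : ℤ) : ℚ))).toAffine.Point, P ≠ 0 ∧ (3 : ℕ) • P = 0)) := by
  have hk := (k_ne_zero_of_consistent h).1
  have hkQ : ((r.k : ℤ) : ℚ) ≠ 0 := by exact_mod_cast hk
  rw [Summit.BirchSwinnertonDyer.BirchSwinnertonDyer.Theorems.PrintCFram.exists_rational_three_torsion_pair_iff
    hkQ]
  obtain ⟨h01, hle, -, -⟩ := tSub_spec_of_consistent h
  constructor
  · exact fun h1 => isSquare_or_of_tSub_eq_one h h1
  · intro hsq
    by_contra hne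
    have ht : r.tSub = 0 ∨ r.tSub = 2 := by omega
    rcases ht with ht | ht
    · -- not regime T: no ℚ₃-point of order 3 on either curve, a fortiori no rational one
      have hreg : r.regime ≠ 1 := fun h1 => (h01.mp h1) ht
      rw [(k_ne_zero_of_consistent h).2, regimeCode_ne_one_iff, tBit_eq, Bool.or_eq_false_iff,
        Bool.eq_false_iff, Bool.eq_false_iff, ne_eq, ne_eq, isSqQ3_iff_isSquare_padic hk,
        isSqQ3_neg_three_mul_iff_isSquare_padic hk] at hreg
      have lift : ∀ z : ℤ, IsSquare ((z : ℤ) : ℚ) → IsSquare ((z : ℤ) : ℚ_[3]) := by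
        rintro z ⟨s, hs⟩
        exact ⟨(s : ℚ_[3]), by exact_mod_cast hs⟩
      rcases hsq with hsq | hsq
      · exact hreg.1 (lift _ hsq)
      · have e : (-3 * ((r.k : ℤ) : ℚ)) = (((-3) * r.k : ℤ) : ℚ) := by push_cast; ring
        rw [e] at hsq
        exact hreg.2 (lift _ hsq)
    · have hns := not_isSquare_of_tSub_eq_two h ht
      rcases hsq with hsq | hsq
      · exact hns.1 hsq
      · exact hns.2 hsq

/-- Hence `tSub = 2` (split type) iff regime T with NO rational point of order `3` on `E_k`, `E_{−27k}`
(the `ℚ₃`-rational `3`-torsion is not rational: `k ∈ ℚ₃ײ ∖ ℚ²` or `−3k ∈ ℚ₃ײ ∖ ℚ²`). [cite: SilvermanAEC2009, Exercise 3.7] -/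
theorem tSub_eq_two_iff {r : PopRow} (h : r.consistent = true) :
    r.tSub = 2 ↔ r.regime = 1 ∧
      ¬ ((∃ P : (mordellCurve ((r.k : ℤ) : ℚ)).toAffine.Point, P ≠ 0 ∧ (3 : ℕ) • P = 0) ∨
        (∃ P : (mordellCurve (-27 * ((r.k : ℤ) : ℚ))).toAffine.Point, P ≠ 0 ∧ (3 : ℕ) • P = 0)) := by
  rw [← tSub_eq_one_iff_exists_rational_threeTorsion h]
  obtain ⟨h01, hle, -, -⟩ := tSub_spec_of_consistent h
  omega

end PopRow

end Summit.BirchSwinnertonDyer.Rank1Residual.X12.CMRamifiedRecords
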